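import Summits.Ventures.DiscreteObjects.PP12.OrderElevenReduction
import Summits.Ventures.DiscreteObjects.PP12.OrderElevenHomologyNoArray
import Summits.Ventures.DiscreteObjects.PP12.OrderElevenTriangleNoData

/-!
# PP(12): the order-11 cell is a KERNEL THEOREM — no projective plane of order 12 admits a collineation of order 11 (assembly; designs g24)
Framing: lottery ticket; floor = certified bounds/negative ranges.

Cell pub-namedobj (venture DiscreteObjects), target (M). Pure assembly of the two kernel certificates of the `p = 11` cell:
* Case A (homology of order 11; fixed antiflag + 11 centre/axis pairs ⇒ a `(11,13;1,1;1)` quasi-difference array): `Homology12.noHomologyArray12`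
  (`OrderElevenHomologyNoArray`, designs g22: 363 multiplier-orbit representatives × 3,441 candidate rows, 19 kernel scans + 18 kernel walks + orbit map);
* Case B (fixed triangle; normalised orthomorphism data of `Z₁₁`): `Triangle12.noTriangleData12` (`OrderElevenTriangleNoData`, designs g23: 11 φ-orbit
  representatives of 3,441, label/partition walker, 27 compatibility scans, max degree 2 < 10);
with the plane-level reduction `noOrderEleven_of_noCollineationOfOrderEleven` (`OrderElevenReduction`, designs g16; converse in `OrderElevenIff`).
Results: **`noCollineationOfOrderEleven : NoCollineationOfOrderEleven`** and **`noOrderElevenOrder12_holds : NoOrderElevenOrder12`** — in print: Janko–van Trung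
1982 (the `{2,3}`-group paper); census words: REPLICATION in the kernel of a theorem in print, no novelty claim, no PP(12) existence / non-existence sentence.
No `sorry`, no new axioms.
-/

namespace Summit.Ventures.DiscreteObjects.PP12

/-- **The `p = 11` cell of PP(12) is a kernel theorem:** both finite array statements (Case A homology arrays, Case B triangle data) are refuted. -/
theorem noCollineationOfOrderEleven : NoCollineationOfOrderEleven :=
  ⟨Homology12.noHomologyArray12, Triangle12.noTriangleData12⟩

/-- **Plane level, `p = 11`:** no projective plane of order 12 admits a collineation `σ ≠ 1` with `σ ^ 11 = 1`. -/
theorem noOrderElevenOrder12_holds : NoOrderElevenOrder12 :=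
  noOrderEleven_of_noCollineationOfOrderEleven noCollineationOfOrderEleven

end Summit.Ventures.DiscreteObjects.PP12
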